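import Mathlib
import HarnessLib
import Summits.HubbardSuperconductivity.HubbardSuperconductivity.Theorems.KLProgrammeKLRegimeEngineTwoShellLatticeCount
import Summits.HubbardSuperconductivity.HubbardSuperconductivity.Theorems.KLProgrammeKLRegimeSplitEdgeFactsComplFamily
import Summits.HubbardSuperconductivity.HubbardSuperconductivity.Theorems.KLProgrammeKLRegimeWickScaleFlowLines

/-!
# Route `KLProgramme` — ENGINE child gen 8 (stmt-HubbardSuperconductivity-20437 `KLRegimeEngineV17F2`), skeleton v2 class #5 rev 3: SUPPORT GEOMETRY of the
# `D`-line rows of `klmd_defectDiff_le_masses_family` — for a DEEP pair (`n + 2 ≤ j′ ≤ j`) the born-overlap mass `WD6` VANISHES and the direct / crossed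
# masses `WDd`, `WDx` VANISH AT SMALL TRANSFER (cell gate-hubbard-kl, seat hubbard-kl-k3c2-p2 g16; KLTC-INDEX v10.3 §D rows «k3c2-p2»)

WHY.  In the ξΔ door of `…MemberDefectRowsMasses` the `D`-weight is `D = s_{n+1,j} − s_{n+1,j′} = s_{j′,j} = χ₂(ρ²/Λ_j²) − χ₂(ρ²/Λ_{j′}²)` (`ρ² = ω² + e_K²`,
`softSymbolCompl_sub_compl_apply` / `softSymbolCompl_eq_profile`): it lives on `ρ ≤ Λ_{j′}`.  The slice line `ẇ_{Λ(t)}` lives on `Λ(t)²/4 ≤ ρ² ≤ Λ(t)²`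
(`klws_deriv_cutoffWeight_scale_eq_zero`), `Λ(t) = Λₙ + t(Λₙ₊₁ − Λₙ) ∈ [Λₙ₊₁, Λₙ]`.  For a DEEP pair, `Λ_{j′} ≤ Λₙ₊₂ = Λₙ₊₁/4 ≤ Λ(t)/4`:
* §1 running scale and the deep `D`-line: `scaleAt_mem`, `klScale_le_quarter_scaleAt`, `dLine_eq_zero_of_le` (`Λ_{j′}² ≤ ρ² ⇒ D = 0`), `abs_dLine_le_one`;
* §2 the torus-Lipschitz bound of the band — `abs_nambuXiCT_add_sub_le`: `|e_K(p_{k̃+q̃}) − e_K(p_k̃)| ≤ G·|p_q̃|_𝕋`, `G = 4 + (8/3)·Gfr₁·U²` (`FrameOK`);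
* §3 **`born_DLine_summand_eq_zero`** / **`WD6_sum_eq_zero`**: the two supports are disjoint ⇒ the born-overlap mass of the pair is `0` for every `t ∈ [0,1]`;
* §4 **`direct_DLine_factors_eq_zero`** / **`WDd_sum_eq_zero_of_small_transfer`**: at equal frequencies a momentum `k` on the `D`-line has `|e_K(k)| < Λ(t)/4` and its
  partner on the slice line has `e_K(k′)² ≥ 3Λ(t)²/16`; so `G·|x − y|_𝕋 ≤ Λ(t)/6` forces EVERY summand of `WDd` to vanish (`(5/12)² < 3/16`);
* §5 **`crossed_DLine_factors_eq_zero`** / **`WDx_sum_eq_zero_of_small_transfer`**: the crossed loop carries the bosonic transfer `2π/β` (`ω_{p′} = ω_p − 2π/β`); with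
  `16π/β ≤ Λₙ₊₁` the same separation gives `WDx = 0` whenever `G·|x + y − Q_m|_𝕋 ≤ Λ(t)/13`.
Above these thresholds the rows are the two-shell counts of `…EngineTwoShellLatticeCount` (next file).  The ADJACENT pair `j′ = n+1` and the MEMBER masses are NOT
covered: there the slice line and the running symbol overlap in `ρ` and the sign-blind masses have no gain (the signed radial rows of `…PairTransferRelBarF`'s
docstring are needed).  Pure support bookkeeping; nothing about the model's sizes is asserted; nothing asserts (X).3, (c), K3 or superconductivity.  0 kit · 0 lit.
-/

noncomputable section

namespace Summit.HubbardSuperconductivity.HubbardSuperconductivity.Theorems.KLRegimeSplit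

set_option linter.dupNamespace false -- summit = problem name (single-conjunct summit), D-0017

open Real Finset Set Literature.MathematicalPhysics.QuantumLattice Literature.Probability.LatticeModels
open Literature.MathematicalPhysics.QuantumLattice.FermiRG
open Summit.HubbardSuperconductivity.HubbardSuperconductivity.Theorems.KLProgrammeLegKernels
open Summit.HubbardSuperconductivity.HubbardSuperconductivity.Theorems.TwoPointAssembly
open Summit.HubbardSuperconductivity.HubbardSuperconductivity.Theorems.DispersionFlow
open Summit.HubbardSuperconductivity.HubbardSuperconductivity.Theorems.PerturbedFermiCurve
open Summit.HubbardSuperconductivity.HubbardSuperconductivity.Theorems.KLRegimeWick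
open Summit.HubbardSuperconductivity.HubbardSuperconductivity.Theorems.EngineV8

variable {L M : ℕ} (β μ : ℝ) (K : TrigPolyC4v)

/-! ## §1 The running scale `Λ(t)` and the deep `D`-line -/

/-- `Λ(t) = Λₙ + t(Λₙ₊₁ − Λₙ) ∈ [Λₙ₊₁, Λₙ]` for `t ∈ [0,1]` (`Λₙ₊₁ = Λₙ/4`). -/
theorem scaleAt_mem (n : ℕ) {t : ℝ} (ht : t ∈ Icc (0 : ℝ) 1) :
    klScale klE0 (n + 1) ≤ klScale klE0 n + t * (klScale klE0 (n + 1) - klScale klE0 n) ∧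
      klScale klE0 n + t * (klScale klE0 (n + 1) - klScale klE0 n) ≤ klScale klE0 n := by
  have hΛ := klth_klScale_pos n
  rw [klth_klScale_succ]
  obtain ⟨h0, h1⟩ := ht
  constructor <;> nlinarith

/-- `0 < Λ(t)` for `t ∈ [0,1]`. -/
theorem scaleAt_pos (n : ℕ) {t : ℝ} (ht : t ∈ Icc (0 : ℝ) 1) : 0 < klScale klE0 n + t * (klScale klE0 (n + 1) - klScale klE0 n) :=
  (klth_klScale_pos (n + 1)).trans_le (scaleAt_mem n ht).1

/-- **Deep pairs sit below a quarter of the running scale**: `n + 2 ≤ j′ ⇒ Λ_{j′} ≤ Λ(t)/4` (`t ∈ [0,1]`). -/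
theorem klScale_le_quarter_scaleAt {n j' : ℕ} (hj' : n + 2 ≤ j') {t : ℝ} (ht : t ∈ Icc (0 : ℝ) 1) :
    klScale klE0 j' ≤ (klScale klE0 n + t * (klScale klE0 (n + 1) - klScale klE0 n)) / 4 := by
  have h1 : klScale klE0 j' ≤ klScale klE0 (n + 2) := klld_klScale_anti hj'
  have h2 : klScale klE0 (n + 2) = klScale klE0 (n + 1) / 4 := klth_klScale_succ (n + 1)
  have h3 := (scaleAt_mem n ht).1
  rw [h2] at h1
  linarith

/-- **The `D`-line lives on `ρ ≤ Λ_{j′}`**: for `j′ ≤ j` and `Λ_{j′}² ≤ ω_k² + e_K(k)²`, `s_{n+1,j}(k) − s_{n+1,j′}(k) = 0`. -/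
theorem dLine_eq_zero_of_le (n : ℕ) {j j' : ℕ} (hjj : j' ≤ j) (k : FreqMomentum L M)
    (h : klScale klE0 j' ^ 2 ≤ matsubaraFreq β M k.1 ^ 2 + nambuXiCT L μ K k.2 ^ 2) :
    softSymbolCompl L M β μ K (n + 1) j k - softSymbolCompl L M β μ K (n + 1) j' k = 0 := by
  rw [softSymbolCompl_sub_compl_apply, softSymbolCompl_eq_profile]
  have hj := klth_klScale_pos j
  have hj' := klth_klScale_pos j'
  have hle : klScale klE0 j ≤ klScale klE0 j' := klld_klScale_anti hjj
  have h1 : 1 ≤ (matsubaraFreq β M k.1 ^ 2 + nambuXiCT L μ K k.2 ^ 2) / klScale klE0 j' ^ 2 := by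
    rw [le_div_iff₀ (by positivity)]; linarith
  have h2 : 1 ≤ (matsubaraFreq β M k.1 ^ 2 + nambuXiCT L μ K k.2 ^ 2) / klScale klE0 j ^ 2 := by
    rw [le_div_iff₀ (by positivity)]
    have : klScale klE0 j ^ 2 ≤ klScale klE0 j' ^ 2 := pow_le_pow_left₀ hj.le hle 2
    linarith
  rw [salmhoferCutoff_of_ge h2, salmhoferCutoff_of_ge h1, sub_self]

/-- `|s_{n+1,j}(k) − s_{n+1,j′}(k)| ≤ 1` (`j′ ≤ j`: `0 ≤ D ≤ 1 − w_{Λ_{j′}} ≤ 1`). -/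
theorem abs_dLine_le_one (n : ℕ) {j j' : ℕ} (hjj : j' ≤ j) (k : FreqMomentum L M) :
    |softSymbolCompl L M β μ K (n + 1) j k - softSymbolCompl L M β μ K (n + 1) j' k| ≤ 1 := by
  obtain ⟨h0, h1⟩ := softSymbolCompl_sub_compl_mem (L := L) (M := M) β μ K (n + 1) hjj k
  simp only [Pi.sub_apply] at h0 h1
  have hw : 0 ≤ hubbardCutoffWeightCT L M β μ K (klScale klE0 j') k := (salmhoferCutoff_mem_Icc _).1
  rw [abs_of_nonneg h0]
  linarith

/-- **Nonvanishing of the `D`-line forces `ρ² < Λ_{j′}²`** (`j′ ≤ j`). -/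
theorem radius_lt_of_dLine_ne_zero (n : ℕ) {j j' : ℕ} (hjj : j' ≤ j) (k : FreqMomentum L M)
    (h : softSymbolCompl L M β μ K (n + 1) j k - softSymbolCompl L M β μ K (n + 1) j' k ≠ 0) :
    matsubaraFreq β M k.1 ^ 2 + nambuXiCT L μ K k.2 ^ 2 < klScale klE0 j' ^ 2 := by
  by_contra hge
  exact h (dLine_eq_zero_of_le β μ K n hjj k (not_lt.1 hge))

/-- **Nonvanishing of the slice line forces `Λ² / 4 ≤ ρ² ≤ Λ²`** (`Λ ≠ 0`). -/
theorem radius_mem_of_slice_ne_zero [NeZero L] {Λ : ℝ} (hΛ : Λ ≠ 0) (k : FreqMomentum L M)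
    (h : deriv (fun Λ' : ℝ => hubbardCutoffWeightCT L M β μ K Λ' k) Λ ≠ 0) :
    Λ ^ 2 / 4 ≤ matsubaraFreq β M k.1 ^ 2 + nambuXiCT L μ K k.2 ^ 2 ∧ matsubaraFreq β M k.1 ^ 2 + nambuXiCT L μ K k.2 ^ 2 ≤ Λ ^ 2 := by
  by_contra hc
  rw [not_and_or, not_le, not_le] at hc
  exact h (klws_deriv_cutoffWeight_scale_eq_zero L M β μ K hΛ k hc)

/-! ## §2 The torus-Lipschitz bound of the frame band -/

/-- **`|e_K(p_{k̃+q̃}) − e_K(p_k̃)| ≤ G·|p_q̃|_𝕋`**, `G = 4 + (8/3)·Gfr₁·U²`, for an admissible frame (`FrameOK R U N μ K`, `0 ≤ R.Gfr j`):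
the band is `2πℤ²`-periodic and `G`-Lipschitz in the sup metric, and `p_{k̃+q̃} ≡ p_k̃ + p_q̃` modulo `2πℤ²`. -/
theorem abs_nambuXiCT_add_sub_le [NeZero L] {R : RenConsts} (hR : ∀ j, 0 ≤ R.Gfr j) {U : ℝ} {N : ℕ} {μ : ℝ} {K : TrigPolyC4v} (hK : FrameOK R U N μ K)
    (k q : TorusSite 2 L) :
    |nambuXiCT L μ K (k + q) - nambuXiCT L μ K k| ≤ (4 + 8 / 3 * R.Gfr 1 * U ^ 2) * klTorusNorm L q := by
  -- the representative of `p_q̃` nearest to `0`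
  set v : Fin 2 → ℝ := fun i => toIocMod Real.two_pi_pos (-π) (latticeMomentum L q i) with hv
  have hvz : ∀ i, ∃ z : ℤ, latticeMomentum L q i = v i + z * (2 * π) := fun i =>
    ⟨toIocDiv Real.two_pi_pos (-π) (latticeMomentum L q i), by
      rw [hv]; have := (toIocMod_add_toIocDiv_zsmul Real.two_pi_pos (-π) (latticeMomentum L q i)); rw [zsmul_eq_mul] at this; linarith⟩
  choose z hz using hvz
  -- `p_{k+q} = p_k + v + 2π·(integer vector)`
  obtain ⟨z₁, hz₁⟩ := latticeMomentum_sub_eq (k + q) q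
  simp only [add_sub_cancel_right] at hz₁
  have hrepr : latticeMomentum L (k + q) = fun i => (latticeMomentum L k i + v i) + 2 * π * ((z i - z₁ i : ℤ) : ℝ) := by
    funext i
    have h1 := congrFun hz₁ i
    rw [hz i] at h1
    push_cast
    linarith
  rw [EngineV8.nambuXiCT_eq_frameLevel L μ K (k + q), EngineV8.nambuXiCT_eq_frameLevel L μ K k, hrepr, frameLevel_toLp, frameLevel_toLp, frameShift_toLp, frameShift_toLp,
    planarBand_periodic]
  have hκ : ∀ k : Fin 2 → ℝ, (∀ i, |k i| ≤ π) → ‖fderiv ℝ (fun k : Fin 2 → ℝ => -K.eval k) k‖ ≤ 8 / 3 * R.Gfr 1 * U ^ 2 :=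
    fun k _ => norm_fderiv_negEval_le_of_frameOK hR hK k
  have h := abs_frameE_sub_le hκ (fun i => latticeMomentum L k i + v i) (latticeMomentum L k)
  have hnorm : ‖((fun i => latticeMomentum L k i + v i) - latticeMomentum L k : Fin 2 → ℝ)‖ ≤ klTorusNorm L q := by
    have e : ((fun i => latticeMomentum L k i + v i) - latticeMomentum L k : Fin 2 → ℝ) = v := by funext i; simp
    rw [e]
    refine (pi_norm_le_iff_of_nonneg (by unfold klTorusNorm KLProgrammeLegKernels.torusSupNorm torusAbs; positivity)).2 fun i => ?_
    rw [Real.norm_eq_abs, hv]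
    unfold klTorusNorm KLProgrammeLegKernels.torusSupNorm torusAbs
    fin_cases i
    · exact le_max_left _ _
    · exact le_max_right _ _
  have hG : 0 ≤ 4 + 8 / 3 * R.Gfr 1 * U ^ 2 := by nlinarith [hR 1, sq_nonneg U]
  have e2 : (sqDispersion (fun i => latticeMomentum L k i + v i) + -K.eval (fun i => latticeMomentum L k i + v i) - μ) -
      (sqDispersion (latticeMomentum L k) + -K.eval (latticeMomentum L k) - μ) =
      (sqDispersion (fun i => latticeMomentum L k i + v i) + -K.eval (fun i => latticeMomentum L k i + v i)) -
        (sqDispersion (latticeMomentum L k) + -K.eval (latticeMomentum L k)) := by ring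
  rw [e2]
  exact h.trans (mul_le_mul_of_nonneg_left hnorm hG)

/-! ## §3 The born-overlap mass of a deep pair vanishes -/

/-- **Slice line and deep `D`-line have disjoint supports**: for `n + 2 ≤ j′ ≤ j`, `t ∈ [0,1]`, every `k`: `ẇ_{Λ(t)}(k)·D(k) = 0`. -/
theorem slice_mul_dLine_eq_zero [NeZero L] (n : ℕ) {j j' : ℕ} (hj' : n + 2 ≤ j') (hjj : j' ≤ j) {t : ℝ} (ht : t ∈ Icc (0 : ℝ) 1) (k : FreqMomentum L M) :
    deriv (fun Λ' : ℝ => hubbardCutoffWeightCT L M β μ K Λ' k) (klScale klE0 n + t * (klScale klE0 (n + 1) - klScale klE0 n)) *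
      (softSymbolCompl L M β μ K (n + 1) j k - softSymbolCompl L M β μ K (n + 1) j' k) = 0 := by
  by_contra hne
  obtain ⟨hW, hD⟩ := mul_ne_zero_iff.1 hne
  have hΛ := scaleAt_pos n ht
  obtain ⟨hlo, -⟩ := radius_mem_of_slice_ne_zero β μ K hΛ.ne' k hW
  have hlt := radius_lt_of_dLine_ne_zero β μ K n hjj k hD
  have hq := klScale_le_quarter_scaleAt hj' ht
  have hj'0 := klth_klScale_pos j'
  nlinarith

/-- **`WD6 = 0` for a deep pair**: the born-overlap mass of `klmd_defectDiff_le_masses_family` (the `D`-weight against the slice line at equal momentum) VANISHES for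
`n + 2 ≤ j′ ≤ j`, `t ∈ [0,1]`. -/
theorem WD6_sum_eq_zero [NeZero L] [NeZero M] (n : ℕ) {j j' : ℕ} (hj' : n + 2 ≤ j') (hjj : j' ≤ j) {t : ℝ} (ht : t ∈ Icc (0 : ℝ) 1) :
    ∑ p : FreqMomentum L M, ∑ _σ : Fin 2, ‖(((deriv (fun Λ' : ℝ => hubbardCutoffWeightCT L M β μ K Λ' p) (klScale klE0 n + t * (klScale klE0 (n + 1) - klScale klE0 n)) : ℝ) : ℂ) *
          (((β * (L : ℝ) ^ 2 : ℝ) : ℂ) * propCT L M β μ K p)) *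
        (((softSymbolCompl L M β μ K (n + 1) j p - softSymbolCompl L M β μ K (n + 1) j' p : ℝ) : ℂ) * (((β * (L : ℝ) ^ 2 : ℝ) : ℂ) * propCT L M β μ K p))‖ = 0 := by
  refine Finset.sum_eq_zero fun p _ => Finset.sum_eq_zero fun σ _ => ?_
  have h := slice_mul_dLine_eq_zero β μ K n hj' hjj ht p
  rw [norm_eq_zero]
  calc _ = ((deriv (fun Λ' : ℝ => hubbardCutoffWeightCT L M β μ K Λ' p) (klScale klE0 n + t * (klScale klE0 (n + 1) - klScale klE0 n)) *
            (softSymbolCompl L M β μ K (n + 1) j p - softSymbolCompl L M β μ K (n + 1) j' p) : ℝ) : ℂ) *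
          ((((β * (L : ℝ) ^ 2 : ℝ) : ℂ) * propCT L M β μ K p) * (((β * (L : ℝ) ^ 2 : ℝ) : ℂ) * propCT L M β μ K p)) := by push_cast; ring
    _ = 0 := by rw [h]; simp

/-! ## §4 The direct mass `WDd` of a deep pair vanishes at small transfer -/

/-- Equal integer labels give equal Matsubara frequencies. -/
theorem matsubaraFreq_eq_of_matsubaraInt_eq {p p' : MatsubaraIdx M} (h : matsubaraInt M p' = matsubaraInt M p) :
    matsubaraFreq β M p' = matsubaraFreq β M p := by
  simp only [matsubaraFreq, h]

/-- The crossed loop's frequency relation: `m′ + 1 = m ⇒ ω_{p′} = ω_p − 2π/β`. -/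
theorem matsubaraFreq_eq_sub_of_matsubaraInt_succ {p p' : MatsubaraIdx M} (h : matsubaraInt M p' + 1 = matsubaraInt M p) :
    matsubaraFreq β M p' = matsubaraFreq β M p - 2 * π / β := by
  have h' : (matsubaraInt M p' : ℝ) = matsubaraInt M p - 1 := by
    have := congrArg (fun z : ℤ => (z : ℝ)) h
    push_cast at this
    linarith
  simp only [matsubaraFreq, h']
  ring

/-- **The separation inequality**: `|e| < Λ/4`, `|e′ − e| ≤ Λ/6` contradict `3Λ²/16 ≤ e′²` (`(5/12)² = 25/144 < 27/144 = 3/16`). -/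
theorem not_sep_of_close {Λ e e' : ℝ} (hΛ : 0 < Λ) (he : e ^ 2 < (Λ / 4) ^ 2) (hd : |e' - e| ≤ Λ / 6) (he' : 3 * Λ ^ 2 / 16 ≤ e' ^ 2) : False := by
  have h1 : |e| < Λ / 4 := abs_lt_of_sq_lt_sq' he (by positivity) |>.2 |> fun h => abs_lt.2 ⟨(abs_lt_of_sq_lt_sq' he (by positivity)).1, h⟩
  have h2 : |e'| < 5 * Λ / 12 := by
    have := abs_sub_abs_le_abs_sub e' e
    linarith
  have h3 : e' ^ 2 < (5 * Λ / 12) ^ 2 := by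
    have h0 : 0 ≤ |e'| := abs_nonneg _
    have := mul_self_lt_mul_self h0 h2
    rw [← sq_abs e']
    nlinarith
  nlinarith

/-- **The direct-row factors vanish at small transfer** (deep pair `n + 2 ≤ j′ ≤ j`, `t ∈ [0,1]`, equal frequencies, momenta `k′ = k + (x − y)`,
`G·|x − y|_𝕋 ≤ Λ(t)/6`): `D(p)·ẇ_{Λ(t)}(p′) = 0` and `ẇ_{Λ(t)}(p)·D(p′) = 0`. -/
theorem direct_DLine_factors_eq_zero [NeZero L] {R : RenConsts} (hR : ∀ j, 0 ≤ R.Gfr j) {U : ℝ} {N : ℕ} (hK : FrameOK R U N μ K) (n : ℕ) {j j' : ℕ} (hj' : n + 2 ≤ j') (hjj : j' ≤ j) {t : ℝ} (ht : t ∈ Icc (0 : ℝ) 1) {x y : TorusSite 2 L}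
    (hq : (4 + 8 / 3 * R.Gfr 1 * U ^ 2) * klTorusNorm L (x - y) ≤ (klScale klE0 n + t * (klScale klE0 (n + 1) - klScale klE0 n)) / 6)
    {p p' : FreqMomentum L M} (hω : matsubaraInt M p'.1 = matsubaraInt M p.1) (hk : p'.2 = p.2 + x - y) :
    (softSymbolCompl L M β μ K (n + 1) j p - softSymbolCompl L M β μ K (n + 1) j' p) *
        deriv (fun Λ' : ℝ => hubbardCutoffWeightCT L M β μ K Λ' p') (klScale klE0 n + t * (klScale klE0 (n + 1) - klScale klE0 n)) = 0 ∧
      deriv (fun Λ' : ℝ => hubbardCutoffWeightCT L M β μ K Λ' p) (klScale klE0 n + t * (klScale klE0 (n + 1) - klScale klE0 n)) *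
        (softSymbolCompl L M β μ K (n + 1) j p' - softSymbolCompl L M β μ K (n + 1) j' p') = 0 := by
  set Λ : ℝ := klScale klE0 n + t * (klScale klE0 (n + 1) - klScale klE0 n) with hΛdef
  have hΛ : 0 < Λ := scaleAt_pos n ht
  have hq4 : klScale klE0 j' ≤ Λ / 4 := klScale_le_quarter_scaleAt hj' ht
  have hj'0 := klth_klScale_pos j'
  have hfreq : matsubaraFreq β M p'.1 = matsubaraFreq β M p.1 := matsubaraFreq_eq_of_matsubaraInt_eq β hω
  have hk' : p'.2 = p.2 + (x - y) := by rw [hk]; abel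
  have hlip : |nambuXiCT L μ K p'.2 - nambuXiCT L μ K p.2| ≤ Λ / 6 := by
    rw [hk']; exact (abs_nambuXiCT_add_sub_le hR hK p.2 (x - y)).trans hq
  have hsq : (klScale klE0 j') ^ 2 ≤ (Λ / 4) ^ 2 := pow_le_pow_left₀ hj'0.le hq4 2
  have e4 : (Λ / 4) ^ 2 = Λ ^ 2 / 16 := by ring
  constructor
  · by_contra hne
    obtain ⟨hD, hW⟩ := mul_ne_zero_iff.1 hne
    have h1 := radius_lt_of_dLine_ne_zero β μ K n hjj p hD
    obtain ⟨h2, -⟩ := radius_mem_of_slice_ne_zero β μ K hΛ.ne' p' hW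
    rw [hfreq] at h2
    have hω2 : 0 ≤ matsubaraFreq β M p.1 ^ 2 := sq_nonneg _
    have hek : 0 ≤ nambuXiCT L μ K p.2 ^ 2 := sq_nonneg _
    have he : nambuXiCT L μ K p.2 ^ 2 < (Λ / 4) ^ 2 := by linarith
    have he' : 3 * Λ ^ 2 / 16 ≤ nambuXiCT L μ K p'.2 ^ 2 := by linarith
    exact not_sep_of_close hΛ he hlip he'
  · by_contra hne
    obtain ⟨hW, hD⟩ := mul_ne_zero_iff.1 hne
    have h1 := radius_lt_of_dLine_ne_zero β μ K n hjj p' hD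
    obtain ⟨h2, -⟩ := radius_mem_of_slice_ne_zero β μ K hΛ.ne' p hW
    rw [hfreq] at h1
    have hω2 : 0 ≤ matsubaraFreq β M p.1 ^ 2 := sq_nonneg _
    have hek : 0 ≤ nambuXiCT L μ K p'.2 ^ 2 := sq_nonneg _
    have he : nambuXiCT L μ K p'.2 ^ 2 < (Λ / 4) ^ 2 := by linarith
    have he' : 3 * Λ ^ 2 / 16 ≤ nambuXiCT L μ K p.2 ^ 2 := by linarith
    rw [abs_sub_comm] at hlip
    exact not_sep_of_close hΛ he hlip he'

/-- The symmetrised summand of the masses door vanishes when both cross products of its weights do. -/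
theorem symm_summand_norm_eq_zero {a b c d : ℝ} {X Y : ℂ} (h1 : a * d = 0) (h2 : c * b = 0) :
    ‖(((a : ℝ) : ℂ) * X) * (((d : ℝ) : ℂ) * Y) + (((c : ℝ) : ℂ) * X) * (((b : ℝ) : ℂ) * Y)‖ = 0 := by
  have h1' : ((a : ℝ) : ℂ) * ((d : ℝ) : ℂ) = 0 := by exact_mod_cast h1
  have h2' : ((c : ℝ) : ℂ) * ((b : ℝ) : ℂ) = 0 := by exact_mod_cast h2
  rw [norm_eq_zero]
  calc _ = (((a : ℝ) : ℂ) * ((d : ℝ) : ℂ)) * (X * Y) + (((c : ℝ) : ℂ) * ((b : ℝ) : ℂ)) * (X * Y) := by ring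
    _ = 0 := by rw [h1', h2']; ring

/-- **`WDd = 0` at small transfer for a deep pair**: the direct mass of `klmd_defectDiff_le_masses_family` (the `D`-weight against the slice line `ẇ_{Λ(t)}` at equal
frequencies and momentum transfer `x − y`) VANISHES whenever `n + 2 ≤ j′ ≤ j`, `t ∈ [0,1]` and `G·|x − y|_𝕋 ≤ Λ(t)/6`, `G = 4 + (8/3)·Gfr₁·U²`. -/
theorem WDd_sum_eq_zero_of_small_transfer [NeZero L] [NeZero M] {R : RenConsts} (hR : ∀ j, 0 ≤ R.Gfr j) {U : ℝ} {N : ℕ} (hK : FrameOK R U N μ K) (n : ℕ) {j j' : ℕ} (hj' : n + 2 ≤ j') (hjj : j' ≤ j) {t : ℝ} (ht : t ∈ Icc (0 : ℝ) 1) {x y : TorusSite 2 L}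
    (hq : (4 + 8 / 3 * R.Gfr 1 * U ^ 2) * klTorusNorm L (x - y) ≤ (klScale klE0 n + t * (klScale klE0 (n + 1) - klScale klE0 n)) / 6) :
    ∑ p : FreqMomentum L M, ∑ _σ : Fin 2, ∑ p' : FreqMomentum L M,
      (if matsubaraInt M p'.1 + matsubaraInt M (omega0 M) = matsubaraInt M p.1 + matsubaraInt M (omega0 M) ∧ p'.2 = p.2 + x - y then
        ‖((((softSymbolCompl L M β μ K (n + 1) j p - softSymbolCompl L M β μ K (n + 1) j' p : ℝ)) : ℂ) * (((β * (L : ℝ) ^ 2 : ℝ) : ℂ) * propCT L M β μ K p)) *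
            ((((deriv (fun Λ' : ℝ => hubbardCutoffWeightCT L M β μ K Λ' p') (klScale klE0 n + t * (klScale klE0 (n + 1) - klScale klE0 n)) : ℝ)) : ℂ) *
              (((β * (L : ℝ) ^ 2 : ℝ) : ℂ) * propCT L M β μ K p')) +
          ((((deriv (fun Λ' : ℝ => hubbardCutoffWeightCT L M β μ K Λ' p) (klScale klE0 n + t * (klScale klE0 (n + 1) - klScale klE0 n)) : ℝ)) : ℂ) *
              (((β * (L : ℝ) ^ 2 : ℝ) : ℂ) * propCT L M β μ K p)) *
            ((((softSymbolCompl L M β μ K (n + 1) j p' - softSymbolCompl L M β μ K (n + 1) j' p' : ℝ)) : ℂ) * (((β * (L : ℝ) ^ 2 : ℝ) : ℂ) * propCT L M β μ K p'))‖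
      else 0) = 0 := by
  refine Finset.sum_eq_zero fun p _ => Finset.sum_eq_zero fun σ _ => Finset.sum_eq_zero fun p' _ => ?_
  split_ifs with hc
  · obtain ⟨hω, hk⟩ := hc
    have hω' : matsubaraInt M p'.1 = matsubaraInt M p.1 := by linarith
    obtain ⟨h1, h2⟩ := direct_DLine_factors_eq_zero β μ K hR hK n hj' hjj ht hq hω' hk
    exact symm_summand_norm_eq_zero h1 h2
  · rfl

/-! ## §5 The crossed mass `WDx` of a deep pair vanishes at small transfer (away from the last scales) -/

/-- The crossed separation inequality: `|e| < Λ/4`, `|e′ − e| ≤ Λ/13` contradict `7Λ²/64 ≤ e′²` (`(1/4 + 1/13)² = 289/2704 < 7/64`). -/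
theorem not_sep_of_close_crossed {Λ e e' : ℝ} (hΛ : 0 < Λ) (he : e ^ 2 < (Λ / 4) ^ 2) (hd : |e' - e| ≤ Λ / 13) (he' : 7 * Λ ^ 2 / 64 ≤ e' ^ 2) :
    False := by
  have h1 : |e| < Λ / 4 := abs_lt.2 ⟨(abs_lt_of_sq_lt_sq' he (by positivity)).1, (abs_lt_of_sq_lt_sq' he (by positivity)).2⟩
  have h2 : |e'| < 17 * Λ / 52 := by
    have := abs_sub_abs_le_abs_sub e' e
    linarith
  have h3 : e' ^ 2 < (17 * Λ / 52) ^ 2 := by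
    have h0 : 0 ≤ |e'| := abs_nonneg _
    have := mul_self_lt_mul_self h0 h2
    rw [← sq_abs e']
    nlinarith
  nlinarith

/-- **The crossed-row factors vanish at small transfer** (deep pair `n + 2 ≤ j′ ≤ j`, `t ∈ [0,1]`, `16π/β ≤ Λₙ₊₁`, crossed frequencies `m′ + 1 = m`, momenta
`k′ = k + (Q_m − x − y)`, `G·|Q_m − x − y|_𝕋 ≤ Λ(t)/13`): `D(p)·ẇ_{Λ(t)}(p′) = 0` and `ẇ_{Λ(t)}(p)·D(p′) = 0`. -/
theorem crossed_DLine_factors_eq_zero [NeZero L] {R : RenConsts} (hR : ∀ j, 0 ≤ R.Gfr j) {U : ℝ} {N : ℕ} (hK : FrameOK R U N μ K) (hβ : 0 < β) (n : ℕ) (hβn : 16 * π / β ≤ klScale klE0 (n + 1)) {j j' : ℕ} (hj' : n + 2 ≤ j') (hjj : j' ≤ j)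
    {t : ℝ} (ht : t ∈ Icc (0 : ℝ) 1) {Qm x y : TorusSite 2 L}
    (hq : (4 + 8 / 3 * R.Gfr 1 * U ^ 2) * klTorusNorm L (Qm - x - y) ≤ (klScale klE0 n + t * (klScale klE0 (n + 1) - klScale klE0 n)) / 13)
    {p p' : FreqMomentum L M} (hω : matsubaraInt M p'.1 + 1 = matsubaraInt M p.1) (hk : p'.2 = p.2 + Qm - x - y) :
    (softSymbolCompl L M β μ K (n + 1) j p - softSymbolCompl L M β μ K (n + 1) j' p) *
        deriv (fun Λ' : ℝ => hubbardCutoffWeightCT L M β μ K Λ' p') (klScale klE0 n + t * (klScale klE0 (n + 1) - klScale klE0 n)) = 0 ∧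
      deriv (fun Λ' : ℝ => hubbardCutoffWeightCT L M β μ K Λ' p) (klScale klE0 n + t * (klScale klE0 (n + 1) - klScale klE0 n)) *
        (softSymbolCompl L M β μ K (n + 1) j p' - softSymbolCompl L M β μ K (n + 1) j' p') = 0 := by
  set Λ : ℝ := klScale klE0 n + t * (klScale klE0 (n + 1) - klScale klE0 n) with hΛdef
  have hΛ : 0 < Λ := scaleAt_pos n ht
  have hq4 : klScale klE0 j' ≤ Λ / 4 := klScale_le_quarter_scaleAt hj' ht
  have hj'0 := klth_klScale_pos j'
  have hth : 2 * π / β ≤ Λ / 8 := by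
    have := (scaleAt_mem n ht).1
    have h16 : 16 * π / β = 8 * (2 * π / β) := by ring
    linarith
  have hth0 : 0 < 2 * π / β := by positivity
  have hfreq : matsubaraFreq β M p'.1 = matsubaraFreq β M p.1 - 2 * π / β := matsubaraFreq_eq_sub_of_matsubaraInt_succ β hω
  have hk' : p'.2 = p.2 + (Qm - x - y) := by rw [hk]; abel
  have hlip : |nambuXiCT L μ K p'.2 - nambuXiCT L μ K p.2| ≤ Λ / 13 := by
    rw [hk']; exact (abs_nambuXiCT_add_sub_le hR hK p.2 (Qm - x - y)).trans hq
  have hsq : (klScale klE0 j') ^ 2 ≤ (Λ / 4) ^ 2 := pow_le_pow_left₀ hj'0.le hq4 2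
  have e4 : (Λ / 4) ^ 2 = Λ ^ 2 / 16 := by ring
  have e38 : (3 * Λ / 8) ^ 2 = 9 * Λ ^ 2 / 64 := by ring
  constructor
  · by_contra hne
    obtain ⟨hD, hW⟩ := mul_ne_zero_iff.1 hne
    have h1 := radius_lt_of_dLine_ne_zero β μ K n hjj p hD
    obtain ⟨h2, -⟩ := radius_mem_of_slice_ne_zero β μ K hΛ.ne' p' hW
    rw [hfreq] at h2
    -- `|ω_p| < Λ/4`, so `|ω_{p′}| < Λ/4 + Λ/8 = 3Λ/8` and `e′² ≥ Λ²/4 − 9Λ²/64 = 7Λ²/64`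
    have hωabs : |matsubaraFreq β M p.1| < Λ / 4 := by
      have hω2 : matsubaraFreq β M p.1 ^ 2 < (Λ / 4) ^ 2 := by linarith [sq_nonneg (nambuXiCT L μ K p.2)]
      exact abs_lt.2 ⟨(abs_lt_of_sq_lt_sq' hω2 (by positivity)).1, (abs_lt_of_sq_lt_sq' hω2 (by positivity)).2⟩
    have hω'abs : |matsubaraFreq β M p.1 - 2 * π / β| < 3 * Λ / 8 := by
      have := abs_sub (matsubaraFreq β M p.1) (2 * π / β)
      rw [abs_of_pos hth0] at this
      linarith
    have hω'sq : (matsubaraFreq β M p.1 - 2 * π / β) ^ 2 < (3 * Λ / 8) ^ 2 := by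
      have h0 : 0 ≤ |matsubaraFreq β M p.1 - 2 * π / β| := abs_nonneg _
      have := mul_self_lt_mul_self h0 hω'abs
      rw [← sq_abs (matsubaraFreq β M p.1 - 2 * π / β)]
      nlinarith
    have he : nambuXiCT L μ K p.2 ^ 2 < (Λ / 4) ^ 2 := by linarith [sq_nonneg (matsubaraFreq β M p.1)]
    have he' : 7 * Λ ^ 2 / 64 ≤ nambuXiCT L μ K p'.2 ^ 2 := by linarith
    exact not_sep_of_close_crossed hΛ he hlip he'
  · by_contra hne
    obtain ⟨hW, hD⟩ := mul_ne_zero_iff.1 hne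
    have h1 := radius_lt_of_dLine_ne_zero β μ K n hjj p' hD
    obtain ⟨h2, -⟩ := radius_mem_of_slice_ne_zero β μ K hΛ.ne' p hW
    rw [hfreq] at h1
    have hω'abs : |matsubaraFreq β M p.1 - 2 * π / β| < Λ / 4 := by
      have hω2 : (matsubaraFreq β M p.1 - 2 * π / β) ^ 2 < (Λ / 4) ^ 2 := by linarith [sq_nonneg (nambuXiCT L μ K p'.2)]
      exact abs_lt.2 ⟨(abs_lt_of_sq_lt_sq' hω2 (by positivity)).1, (abs_lt_of_sq_lt_sq' hω2 (by positivity)).2⟩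
    have hωabs : |matsubaraFreq β M p.1| < 3 * Λ / 8 := by
      have := abs_sub_abs_le_abs_sub (matsubaraFreq β M p.1) (2 * π / β)
      have e : |matsubaraFreq β M p.1| - |2 * π / β| ≤ |matsubaraFreq β M p.1 - 2 * π / β| := this
      rw [abs_of_pos hth0] at e
      linarith
    have hωsq : matsubaraFreq β M p.1 ^ 2 < (3 * Λ / 8) ^ 2 := by
      have h0 : 0 ≤ |matsubaraFreq β M p.1| := abs_nonneg _
      have := mul_self_lt_mul_self h0 hωabs
      rw [← sq_abs (matsubaraFreq β M p.1)]
      nlinarith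
    have he : nambuXiCT L μ K p'.2 ^ 2 < (Λ / 4) ^ 2 := by linarith [sq_nonneg (matsubaraFreq β M p.1 - 2 * π / β)]
    have he' : 7 * Λ ^ 2 / 64 ≤ nambuXiCT L μ K p.2 ^ 2 := by linarith
    rw [abs_sub_comm] at hlip
    exact not_sep_of_close_crossed hΛ he hlip he'

/-- **`WDx = 0` at small transfer for a deep pair**: the crossed mass of `klmd_defectDiff_le_masses_family` (the `D`-weight against the slice line at the crossed
frequencies `m′ + 1 = m` and momentum transfer `Q_m − x − y`) VANISHES whenever `n + 2 ≤ j′ ≤ j`, `t ∈ [0,1]`, `16π/β ≤ Λₙ₊₁` and `G·|Q_m − x − y|_𝕋 ≤ Λ(t)/13`. -/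
theorem WDx_sum_eq_zero_of_small_transfer [NeZero L] [NeZero M] {R : RenConsts} (hR : ∀ j, 0 ≤ R.Gfr j) {U : ℝ} {N : ℕ} (hK : FrameOK R U N μ K) (hβ : 0 < β) (n : ℕ) (hβn : 16 * π / β ≤ klScale klE0 (n + 1)) {j j' : ℕ} (hj' : n + 2 ≤ j') (hjj : j' ≤ j)
    {t : ℝ} (ht : t ∈ Icc (0 : ℝ) 1) {Qm x y : TorusSite 2 L}
    (hq : (4 + 8 / 3 * R.Gfr 1 * U ^ 2) * klTorusNorm L (Qm - x - y) ≤ (klScale klE0 n + t * (klScale klE0 (n + 1) - klScale klE0 n)) / 13) :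
    ∑ p : FreqMomentum L M, ∑ p' : FreqMomentum L M,
      (if matsubaraInt M p'.1 + matsubaraInt M (omega0 M) + matsubaraInt M (omega0 M) + 1 = matsubaraInt M p.1 ∧ p'.2 = p.2 + Qm - x - y then
        ‖((((softSymbolCompl L M β μ K (n + 1) j p - softSymbolCompl L M β μ K (n + 1) j' p : ℝ)) : ℂ) * (((β * (L : ℝ) ^ 2 : ℝ) : ℂ) * propCT L M β μ K p)) *
            ((((deriv (fun Λ' : ℝ => hubbardCutoffWeightCT L M β μ K Λ' p') (klScale klE0 n + t * (klScale klE0 (n + 1) - klScale klE0 n)) : ℝ)) : ℂ) *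
              (((β * (L : ℝ) ^ 2 : ℝ) : ℂ) * propCT L M β μ K p')) +
          ((((deriv (fun Λ' : ℝ => hubbardCutoffWeightCT L M β μ K Λ' p) (klScale klE0 n + t * (klScale klE0 (n + 1) - klScale klE0 n)) : ℝ)) : ℂ) *
              (((β * (L : ℝ) ^ 2 : ℝ) : ℂ) * propCT L M β μ K p)) *
            ((((softSymbolCompl L M β μ K (n + 1) j p' - softSymbolCompl L M β μ K (n + 1) j' p' : ℝ)) : ℂ) * (((β * (L : ℝ) ^ 2 : ℝ) : ℂ) * propCT L M β μ K p'))‖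
      else 0) = 0 := by
  refine Finset.sum_eq_zero fun p _ => Finset.sum_eq_zero fun p' _ => ?_
  split_ifs with hc
  · obtain ⟨hω, hk⟩ := hc
    have hω' : matsubaraInt M p'.1 + 1 = matsubaraInt M p.1 := by simpa [matsubaraInt_omega0] using hω
    obtain ⟨h1, h2⟩ := crossed_DLine_factors_eq_zero β μ K hR hK hβ n hβn hj' hjj ht hq hω' hk
    exact symm_summand_norm_eq_zero h1 h2
  · rfl

end Summit.HubbardSuperconductivity.HubbardSuperconductivity.Theorems.KLRegimeSplit

end
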